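import Summits.QuantumFields.BalabanUV.Beta.D1BFx.Criticality

/-!
# `BalabanUV.Beta.D1BFx.CriticalityWall` — road «BF-x» for binder row D1, leaf K-R4 (criticality / chain-rule CHECK), part 3:
# at the wall's member `0` the second-response summand of the typed second-order carrier contributes to the tadpole EXACTLY
# `cVH ·` (the second response's field columns) · (the vh ONE-POINT FUNCTIONS `tadpole K (mfNeg (vhS d Lc κ u))`) — the Wilson and the
# multiplier one-point functions being ZERO by parity (part 1) — for ANY sgn-symmetric spread propagator, in particular every `KInvStep Lc j`

HONEST FRAMING (cell contract, verbatim): «discharging `BetaPertH` makes Bałaban's UV stability UNCONDITIONAL — a real constructive-QFT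
result; it is NOT the continuum limit and NOT the Clay problem.»  This module is [folklore] bookkeeping over the cell's typed objects BY NAME
(parts 1–2 `D1BFx/TadpoleParity` / `D1BFx/Criticality`, `SecondOrderResponse.vertexFamily_K2OfK`, `BalabanStepW2.locStencil_Spure/vertexFamily_M1`,
`OneStepKernelFamily.decays_KInvStep`, `BubbleParity.trK_KInvStep`).  It cites nothing, mints no `Prop`, instantiates no binder of the β-function
wall and discharges nothing of it.  NOT summit progress; NOT BetaPertH, NOT continuum, NOT Clay.
HONEST DEPENDENCY: continuum YM on T⁴ ⇐ BetaPertH ∧ nine spine estimates (0/9 proved); BetaPertH ⇐ (D1) ∧ (D4) ∧ CAP+tail; G-an2-4 gates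
asym, D1 and NE2/3/4.

THE K-R4 VERDICT THESE THREE FILES CERTIFY (claim table `HOME/b2b-balaban-beta-d1-p2/LEAVES-BFx.md` row K-R4; QUESTION X-d1p2-2, journal
l.5435, options (a)/(b)/(c)).  The fourth summand `dM (K2OfK K Lc S M ν y′) Lc S M μ y` of `SecondOrderResponse.W2OfK` (the tables of
`BalabanStepW2.WbalOf … 0`: `S = Spure 0 = cE•wilsonA + cVH•mfNeg vhS`, `M = M1 0 = (cΛ·wM1 0)•hessFF`) enters `hessKer` through its tadpole, which is
(`Criticality.tadpole_dM`) the superposition of the ONE-POINT FUNCTIONS of `S κ u` and `M ρ w` weighted by the columns of the second response.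
(a) HOLDS for the Wilson piece and for the multiplier table — `tadpole K (wilsonA κ u) = 0`, `tadpole K (M1 … ρ w) = 0` for every sgn-symmetric
spread `K` (part 1: plain-antisymmetric BLOCK-DIAGONAL tables against `Kᵀ = sgnK K`); (b) is STRUCTURALLY UNAVAILABLE — the summand carries no
weight of its own (it is bilinear in the weights already carried by `S`, `M`); what is LEFT is (this file) exactly
`cVH · Σ_κ Σ'_u colH (K2OfK …) Lc μ y κ u · tadpole K (mfNeg (vhS d Lc κ u))`: the one-step border («vh») table is OFF-diagonal, where parity is
silent, so in the colourless model the second-response term is present UNLESS the vh one-point function `tadpole (KInvStep Lc 0) (mfNeg (vhS d Lc κ u))`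
vanishes identically in `(κ, u)` — the residual, finite, explicit question of K-R4 (in Bałaban's model the term is zero by `tr_C (ad t_e) = 0`,
B12 (4.35); context only).  Nothing about that value is asserted here.
-/

open Finset
open scoped BigOperators
open Literature.MathematicalPhysics.QuantumFieldTheory
open Literature.MathematicalPhysics.QuantumFieldTheory.Balaban1983to89
open Literature.MathematicalPhysics.QuantumFieldTheory.Balaban1983to89.Beta
open ExpKernelCalculus (MKer Decays BiLoc tadpole VertexFamily)
open OneStepResolventKernel (Fib LocStencil)
open OneStepKernelFamily (KInvStep colH decays_KInvStep)
open SecondOrderResponse (dM K2OfK vertexFamily_K2OfK)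
open StepJetData (mfNeg)
open AveragingHessianKernels (vhS)
open BalabanStepW2 (Spure M1 locStencil_Spure vertexFamily_M1)
open Summit.QuantumFields.BalabanUV.Beta.TameKernelCalculus
open Summit.QuantumFields.BalabanUV.Beta.BorderedHessian (sgnK)
open Summit.QuantumFields.BalabanUV.Beta.BubbleParity (trK_KInvStep)
open Summit.QuantumFields.BalabanUV.Beta.D1BFx.TadpoleParity (tadpole_Spure_zero tadpole_M1_eq_zero)
open Summit.QuantumFields.BalabanUV.Beta.D1BFx.Criticality (tadpole_dM)

namespace Summit.QuantumFields.BalabanUV.Beta.D1BFx.CriticalityWall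

noncomputable section

variable {d : ℕ} {Lc : ℕ} [NeZero Lc]

/-- [folklore] **K-R4 AT THE WALL'S MEMBER `0`, abstract response.**  For ANY sgn-symmetric spread propagator `K` (`Kᵀ = sgnK K`) and ANY
bi-localised response kernel `K′`, with the member-`0` tables `S := Spure … 0`, `M := M1 … 0` of `BalabanStepW2.WbalOf`:
`tadpole K (dM K′ Lc S M μ y) = cVH · Σ_κ Σ'_u colH K′ Lc μ y κ u · tadpole K (mfNeg (vhS d Lc κ u))` — the multiplier one-point functions and the
Wilson ones vanish by parity (part 1); EXACTLY the vh ones survive.  Nothing is asserted about their value. -/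
theorem tadpole_dM_Spure_zero {K K' : MKer (d + 1) (Fib d)} (hK : Spr K) (hKt : trK K = sgnK K) (hLc : 1 ≤ Lc)
    {q : Fin (d + 1) → ℤ} {C' m : ℝ} (hK' : BiLoc K' q q C' m) (hm : 0 < m) (cE cVH cΛ : ℝ)
    {Cs δs : ℝ} (hS : LocStencil (Spure d Lc cE cVH cΛ 0) Cs δs) (hδs : 0 < δs)
    {CM δM : ℝ} (hM : VertexFamily (M1 d Lc cΛ 0) Lc CM δM) (hδM : 0 < δM) (μ : Fin (d + 1)) (y : Fin (d + 1) → ℤ) :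
    tadpole K (dM K' Lc (Spure d Lc cE cVH cΛ 0) (M1 d Lc cΛ 0) μ y) =
      cVH * ∑ κ : Fin (d + 1), ∑' u, colH K' Lc μ y κ u * tadpole K (mfNeg (vhS d Lc κ u)) := by
  rw [tadpole_dM hK hK' hm hS hδs hM hδM μ y]
  have h2 : ∀ ρ w, tadpole K (M1 d Lc cΛ 0 ρ w) = 0 := fun ρ w => tadpole_M1_eq_zero hK hKt hLc cΛ 0 ρ w
  have h1 : ∀ κ u, tadpole K (Spure d Lc cE cVH cΛ 0 κ u) = cVH * tadpole K (mfNeg (vhS d Lc κ u)) :=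
    fun κ u => tadpole_Spure_zero hK hKt hLc cE cVH cΛ κ u
  simp only [h1, h2, mul_zero, tsum_zero, Finset.sum_const_zero, add_zero]
  rw [Finset.mul_sum]
  refine Finset.sum_congr rfl fun κ _ => ?_
  rw [← tsum_mul_left]
  exact tsum_congr fun u => by ring

/-- [folklore] **K-R4 AT THE WALL'S MEMBER `0`, the genuine second response.**  For any sgn-symmetric DECAYING propagator `K`, the
fourth summand of `W2OfK K Lc (Spure … 0) (M1 … 0) S₂ M₂ μ y ν y′` has tadpole EXACTLY
`cVH · Σ_κ Σ'_u colH (K2OfK K Lc (Spure … 0) (M1 … 0) ν y′) Lc μ y κ u · tadpole K (mfNeg (vhS d Lc κ u))` (the second response is bi-localised: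
`SecondOrderResponse.vertexFamily_K2OfK`, rates normalised to the common `min`). -/
theorem tadpole_resp_member_zero {K : MKer (d + 1) (Fib d)} {C m : ℝ} (hKd : Decays K C m) (hm : 0 < m) (hKt : trK K = sgnK K)
    (hLc : 1 ≤ Lc) (cE cVH cΛ : ℝ) (μ : Fin (d + 1)) (y : Fin (d + 1) → ℤ) (ν : Fin (d + 1)) (y' : Fin (d + 1) → ℤ) :
    tadpole K (dM (K2OfK K Lc (Spure d Lc cE cVH cΛ 0) (M1 d Lc cΛ 0) ν y') Lc (Spure d Lc cE cVH cΛ 0) (M1 d Lc cΛ 0) μ y) =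
      cVH * ∑ κ : Fin (d + 1), ∑' u,
        colH (K2OfK K Lc (Spure d Lc cE cVH cΛ 0) (M1 d Lc cΛ 0) ν y') Lc μ y κ u * tadpole K (mfNeg (vhS d Lc κ u)) := by
  obtain ⟨Cs, δs, hδs, hS⟩ := locStencil_Spure (d := d) (Lc := Lc) hLc cE cVH cΛ 0
  -- common rate for the second response's localisation
  set r : ℝ := min m δs with hr
  have hrpos : 0 < r := lt_min hm hδs
  have hKr : Decays K (|C|) r := decays_of_le hKd (min_le_left _ _)
  have hSr : LocStencil (Spure d Lc cE cVH cΛ 0) (|Cs|) r := fun κ u => biLoc_of_le (hS κ u) (min_le_right _ _)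
  have hMr := vertexFamily_M1 (d := d) hLc cΛ 0 hrpos.le
  have hK2 := vertexFamily_K2OfK (N := Lc) hKr (abs_nonneg C) hrpos hSr hMr ν y'
  exact tadpole_dM_Spure_zero ⟨C, m, hm, hKd⟩ hKt hLc hK2 (by positivity) cE cVH cΛ hS hδs hMr hrpos μ y

/-- [folklore] **K-R4 AT THE STEP RESOLVENTS** (`K := KInvStep Lc j`: sgn-symmetric `BubbleParity.trK_KInvStep`, decaying
`OneStepKernelFamily.decays_KInvStep`; `j = 0` is the wall's member `0` / road BF-x's one-shot object at blocking `Lc`): the second-response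
summand's tadpole is `cVH ·` the second response's field columns against the vh one-point functions `tadpole (KInvStep Lc j) (mfNeg (vhS d Lc κ u))`. -/
theorem tadpole_resp_member_zero_KInvStep (hLc : 1 ≤ Lc) (j : ℕ) (cE cVH cΛ : ℝ) (μ : Fin (d + 1)) (y : Fin (d + 1) → ℤ)
    (ν : Fin (d + 1)) (y' : Fin (d + 1) → ℤ) :
    tadpole (KInvStep (d := d) Lc j)
        (dM (K2OfK (KInvStep (d := d) Lc j) Lc (Spure d Lc cE cVH cΛ 0) (M1 d Lc cΛ 0) ν y') Lc (Spure d Lc cE cVH cΛ 0)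
          (M1 d Lc cΛ 0) μ y) =
      cVH * ∑ κ : Fin (d + 1), ∑' u,
        colH (K2OfK (KInvStep (d := d) Lc j) Lc (Spure d Lc cE cVH cΛ 0) (M1 d Lc cΛ 0) ν y') Lc μ y κ u *
          tadpole (KInvStep (d := d) Lc j) (mfNeg (vhS d Lc κ u)) := by
  obtain ⟨δ, C, hδ, _hC, hKd⟩ := decays_KInvStep (d := d) (Lc := Lc) j
  exact tadpole_resp_member_zero hKd hδ (trK_KInvStep Lc j) hLc cE cVH cΛ μ y ν y'

/-- [folklore] **THE (a)-CRITERION AT MEMBER `0`.**  If the vh one-point function vanishes identically — `tadpole K (mfNeg (vhS d Lc κ u)) = 0`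
for all `(κ, u)` (NOT asserted; the residual question of K-R4) — then the second-response summand has no tadpole at all against `K`. -/
theorem tadpole_resp_member_zero_eq_zero_of_vh {K : MKer (d + 1) (Fib d)} {C m : ℝ} (hKd : Decays K C m) (hm : 0 < m)
    (hKt : trK K = sgnK K) (hLc : 1 ≤ Lc) (cE cVH cΛ : ℝ) (hvh : ∀ κ u, tadpole K (mfNeg (vhS d Lc κ u)) = 0)
    (μ : Fin (d + 1)) (y : Fin (d + 1) → ℤ) (ν : Fin (d + 1)) (y' : Fin (d + 1) → ℤ) :
    tadpole K (dM (K2OfK K Lc (Spure d Lc cE cVH cΛ 0) (M1 d Lc cΛ 0) ν y') Lc (Spure d Lc cE cVH cΛ 0) (M1 d Lc cΛ 0) μ y) = 0 := by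
  rw [tadpole_resp_member_zero hKd hm hKt hLc cE cVH cΛ μ y ν y']
  simp [hvh]

end

end Summit.QuantumFields.BalabanUV.Beta.D1BFx.CriticalityWall
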